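/-
Copyright (c) 2026 the pub-hodgecm-mathlib formalisation cell (harness21).  Typist seat hodgecm-mathlib-R90-CS-typ2 (g3) (S8 FILE A∕B pen), Track B ∕ K2-LIT, h413 = `stmt-HodgeConjecture-24833`,
R90-TF section S8 «ContSpec-n½», (R)′ road; S8 dealer R90-CS-plan (g3) PROPOSAL P-S8-ED8 (S8-R201 (1), 2026-09-05T01:18:13Z) item (i) «τ-admissible generator predicate + `resGMidBlockτ`
+ `resGMidBlockτ_le_resGMidBlock`», τ-ADMISSIBLE exactly as RULED in S8-R199 (J-S8-ADM′); ON THE SHELF — for R90-TF LEAD K2E1-plan (g8) to rule «ED. 8 = yes ∕ no» at leisure, NOT inside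
F13 window №2; audit note R90-CS-audit1 (g3) J-S8-W1 (label of record for `hW1`: L, UNPRINTED AS TYPED).
-/
import Summits.HodgeConjecture.HodgeConjecture.Theorems.R90S8ResGMidAtomU3Defs        -- ★ p862682 (K2E1-p11): D1 `resGMidAtomGen`, D2 `resGMidAtom`, D3 `resGMidBlock` (+ `resGMidAtom_le_resGMidBlock`, `resGMidBlock_le`)
import Literature.NumberTheory.Automorphic.UnitaryGroupAdelicProduct                    -- ★ `UnitaryGroup.finPart`, `archPart`, `commute_archToAdelic_finAdelicToAdelic`; brings ★ `finAdelic`, `finAdelicToAdelic`,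
                                                                                        --   `finAdelicIntegralLevel`, ★ `arch`, `archToAdelic`
import Literature.NumberTheory.Automorphic.ReductionTheoryGLn                           -- ★ `standardMaximalCompactGL` (`K = K_∞·GL₃(𝒪̂)`)
import HarnessLib

/-!
# R90-TF · S8 «ContSpec-n½» — `R90S8ResGMidAtomTauU3Defs` (P-S8-ED8 (i), ON THE SHELF): THE τ-ADMISSIBLE MIDDLE-POLE RESIDUE ATOMS `resGMidAtomτ ξ μω U₀` AND THEIR INVARIANT CLOSED
# HULL `resGMidBlockτ ξ μω ≤ resGMidBlock ξ μω`

Cell `hodgecm-mathlib`, crux H413 (`stmt-HodgeConjecture-24833`, lane `--supports … --as helper`), route of record `HCCMUnconditional`; R90-TF section S8.  DEFINITIONS + READ-BACKS ONLY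
(no `instance`, no notation, no named-fact hypothesis, no `sorry`; default heartbeats); count-neutral; CLOSES NO SOCKET; NOT IMPORTED BY ANY `Lines/` FILE UNTIL LEAD SAYS «ED. 8 = yes».

WHY (K2E1-p10 (g5) structural finding F1 01:10Z; S8 dealer S8-R197 → S8-R199 (J-S8-ADM′) → S8-R201; R90-CS-audit1 (g3) audit note J-S8-W1).  ★ D1 `resGMidAtomGen ξ μω K′ ω` admits EVERY
continuous pair-section `φ ∈ V(χ₁, χ₂; K′, ω)` at EVERY `(K′, ω)` (`K′ = ⊥` admits all), with continuation data pointwise in `g` only; ★ D3 `resGMidBlock ξ μω` is the closed `G(𝔸)`-hull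
of ALL these atoms.  Every ★ export head pays Eisenstein data at ADMISSIBLE generators only, and the letter that bridges the gap — `hW1 : resGMidBlock ≤ generate (⋃ τ-admissible atoms)`
— is, AS TYPED, a regularity statement about a.e.-`L²` pointwise residues of merely continuous, non-`K`-finite sections: L, UNPRINTED AS TYPED (printed for `K`-finite ∕ smooth sections
only: [MW95 I.2.17 (iii), II.1; Rog90 §13.9]).  So the (R)′ socket `sock_S8_res_midBlock_le_residual` of S8 FILE B ED. 7 (:337) is, at non-admissible generators, exactly as true as
`hW1`.  P-S8-ED8 = the insurance (O1): a B ED. 8 «τ-ADMISSIBLE BLOCK» re-pointing (E)∕(M)∕(R)′∕(V)∕(V♭) to the hull of the τ-ADMISSIBLE atoms only — (R)′∕(M)∕(V♭) become WEAKER (smaller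
block), (E)∕(V) STRONGER but equal to the printed statements (`L²_res` IS the closed span of residues of `K`-finite Eisenstein series [MW95 II.1, V.3.13]; the (V) witness of record IS
τ-admissible, S8-R199) — honest bookkeeping in the B ED. 8 census, not here.  THIS FILE only types the carrier, in ★ D1–D3's currency and S8-R199's words:

τ-ADMISSIBLE GENERATOR (S8-R199, verbatim): level `K′ = ι_f(U₀)` for `U₀ ≤ G(𝒪̂)_f` open compact — NO archimedean component —, right character `ω = 1`, section `φ ∈ chiSectionSpacePair
χ₁ χ₂ K′ 1` continuous AND `K_∞`-FINITE (`FiniteDimensional (span {r(k)φ | k ∈ K_∞})`); the continuation ∕ pole-letter ∕ a.e. clauses are ★ D1's byte for byte.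
* T1 `IsTauLevel U₀` (`U₀ : Subgroup G(𝔸_f)` open, compact, `≤ finAdelicIntegralLevel = G(𝒪̂)_f`) · `tauLevel U₀ := U₀.map ι_f ≤ G(𝔸)` + `mem_tauLevel_iff`, `finAdelicToAdelic_mem_tauLevel`.
* T2 `archMaximalCompact := K.comap adelicVal ⊓ range ι_∞` (`ι(K_∞) ≤ G(𝔸)`, the tree's `hKinf` convention ★ `archToAdelic_mem_levelOfRecord`) + `archToAdelic_mem_archMaximalCompact`;
  `archTranslateSpan φ := span {r(k)φ | k ∈ ι(K_∞)}` (★ `AdelicGroupData.rightTranslation`) + `rightTranslation_mem_archTranslateSpan`, `mem_archTranslateSpan_self`;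
  `IsArchFinite φ := FiniteDimensional ℂ (archTranslateSpan φ)` + `isArchFinite_iff`.
* T3 `resGMidAtomGenτ ξ μω U₀` (★ D1's clause list at `(K′, ω) := (tauLevel U₀, 1)` with ONE more binder `IsArchFinite φ`) + `mem_resGMidAtomGenτ_iff` (`Iff.rfl`),
  **`resGMidAtomGenτ_subset`** (`⊆ resGMidAtomGen ξ μω (tauLevel U₀) 1` — drop the binder); `resGMidAtomτ ξ μω U₀ := closure (span …)` + `resGMidAtomτ_def`, `subset_resGMidAtomτ`,
  `isClosed_resGMidAtomτ`, `mem_resGMidAtomτ_of_mem_gen`, **`resGMidAtomτ_le_resGMidAtom`**.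
* T4 **`resGMidBlockτ ξ μω := ClosedSubrep.generate R_μ (⋃ U₀, IsTauLevel U₀, resGMidAtomτ ξ μω U₀)`** + `resGMidBlockτ_def`, `resGMidAtomτ_le_resGMidBlockτ`, `mem_resGMidBlockτ_of_mem_gen`,
  `resGMidBlockτ_ne_bot_of_mem` ((V)τ interface), `resGMidBlockτ_le` (minimality), **`resGMidBlockτ_le_resGMidBlock`** (the (R)′∕(M)∕(V♭) junction: one `le_trans`),
  `resGMidBlockτ_eq_bot_of_resGMidBlock_eq_bot` ((V♭)τ from (V♭) verbatim), `iSup_resGMidBlockτ_le_iSup_resGMidBlock` ((E)'s index passage, family form).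
HONEST LABEL: HC_CM is proved only modulo the 7 printed citations (2 remaining named inputs: hLiu418 = `stmt-HodgeConjecture-24832`, h413 = `stmt-HodgeConjecture-24833`) until rung 0
closes; definitions pay nothing; no socket is re-pointed by this file (that is B ED. 8, LEAD's call); `hW1` stays L, unprinted as typed; REL ≠ ★ ≠ WRITTEN ≠ BUILT; count-neutral.

## References
* [MoeglinWaldspurger1995] C. Mœglin, J.-L. Waldspurger, *Spectral Decomposition and Eisenstein Series* (1995), I.2.17, II.1, IV.1.11, V.3.13.
* [Rogawski1990] J. D. Rogawski, *Automorphic Representations of Unitary Groups in Three Variables* (1990), §12.2 (3) p. 173, §13.9 (ii) p. 229.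
* [BorelJacquet1979] A. Borel, H. Jacquet, *Automorphic forms and automorphic representations*, Proc. Symp. Pure Math. 33.1 (1979), §1.3, §4.1, §4.2.
-/

set_option autoImplicit false
set_option linter.dupNamespace false  -- the mandated namespace `…HodgeConjecture.HodgeConjecture.R90.S8` (LEAD #1 L1) repeats the summit's segment

noncomputable section

open MeasureTheory Measure Set Filter Topology NumberField
open Literature.NumberTheory.Automorphic Literature.NumberTheory.Automorphic.UnitaryGroup Literature.NumberTheory.GaloisRepresentations AdelicGroupData
open Literature.NumberTheory.Automorphic.Arthur2013.Leaves.TECR Literature.NumberTheory.Rogawski1990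
open Summit.HodgeConjecture.HodgeConjecture.Cruxes.H413.K2E1BorelEisensteinU
open Summit.HodgeConjecture.HodgeConjecture.Cruxes.H413.K2E1ChiSectionSpaceU3PairDefs
open ContRepresentation
open scoped ENNReal NNReal

namespace Summit.HodgeConjecture.HodgeConjecture.R90.S8

variable (L : Type) [Field L] [NumberField L] [IsCMField L]

/-! ## T1 τ-admissible finite levels `U₀ ≤ G(𝒪̂)_f` (open compact, NO archimedean component) and the level `ι_f(U₀) ≤ G(𝔸)` -/

/-- **T1 — τ-ADMISSIBLE FINITE LEVEL** (S8-R199): `U₀ ≤ G(𝔸_{L⁺,f})` is open, compact and contained in the integral level `G(𝒪̂)_f` (★ `finAdelicIntegralLevel`); the levels of record `K(𝔫)_f`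
(★ `finCongruenceLevel`, ★ `isOpen_finCongruenceLevel`, ★ `isCompact_finCongruenceLevel`, ★ `finCongruenceLevel_le_integralLevel`) qualify. [cite: BorelJacquet1979, §4.1]
[cite: MoeglinWaldspurger1995, I.2.17] -/
def IsTauLevel (U₀ : Subgroup ↥(finAdelic (↥(maximalRealSubfield L)) L (IsCMField.complexConj L) 3 ((StdForm.antidiagonal 3).over L))) : Prop :=
  IsOpen ((U₀ : Subgroup ↥(finAdelic (↥(maximalRealSubfield L)) L (IsCMField.complexConj L) 3 ((StdForm.antidiagonal 3).over L))) :
      Set ↥(finAdelic (↥(maximalRealSubfield L)) L (IsCMField.complexConj L) 3 ((StdForm.antidiagonal 3).over L))) ∧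
    IsCompact ((U₀ : Subgroup ↥(finAdelic (↥(maximalRealSubfield L)) L (IsCMField.complexConj L) 3 ((StdForm.antidiagonal 3).over L))) :
      Set ↥(finAdelic (↥(maximalRealSubfield L)) L (IsCMField.complexConj L) 3 ((StdForm.antidiagonal 3).over L))) ∧
    U₀ ≤ finAdelicIntegralLevel (↥(maximalRealSubfield L)) L (IsCMField.complexConj L) 3 ((StdForm.antidiagonal 3).over L)

/-- Read-back (`Iff.rfl`): the three clauses of `IsTauLevel`. [cite: BorelJacquet1979, §4.1] -/
theorem isTauLevel_iff (U₀ : Subgroup ↥(finAdelic (↥(maximalRealSubfield L)) L (IsCMField.complexConj L) 3 ((StdForm.antidiagonal 3).over L))) :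
    IsTauLevel L U₀ ↔
      IsOpen ((U₀ : Subgroup ↥(finAdelic (↥(maximalRealSubfield L)) L (IsCMField.complexConj L) 3 ((StdForm.antidiagonal 3).over L))) :
          Set ↥(finAdelic (↥(maximalRealSubfield L)) L (IsCMField.complexConj L) 3 ((StdForm.antidiagonal 3).over L))) ∧
        IsCompact ((U₀ : Subgroup ↥(finAdelic (↥(maximalRealSubfield L)) L (IsCMField.complexConj L) 3 ((StdForm.antidiagonal 3).over L))) :
          Set ↥(finAdelic (↥(maximalRealSubfield L)) L (IsCMField.complexConj L) 3 ((StdForm.antidiagonal 3).over L))) ∧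
        U₀ ≤ finAdelicIntegralLevel (↥(maximalRealSubfield L)) L (IsCMField.complexConj L) 3 ((StdForm.antidiagonal 3).over L) :=
  Iff.rfl

/-- **T1 — THE τ-LEVEL `ι_f(U₀) ≤ G(𝔸)`** (no archimedean component: the image of `U₀` under ★ `finAdelicToAdelic`, `g_f ↦ (1, g_f)`). [cite: BorelJacquet1979, §4.1] -/
def tauLevel (U₀ : Subgroup ↥(finAdelic (↥(maximalRealSubfield L)) L (IsCMField.complexConj L) 3 ((StdForm.antidiagonal 3).over L))) :
    Subgroup (quasiSplit (↥(maximalRealSubfield L)) L (IsCMField.complexConj L) 3).Adelic :=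
  U₀.map (finAdelicToAdelic (↥(maximalRealSubfield L)) L (IsCMField.complexConj L) 3 ((StdForm.antidiagonal 3).over L))

/-- Membership in the τ-level: `k ∈ ι_f(U₀) ↔ ∃ b ∈ U₀, ι_f b = k`. [cite: BorelJacquet1979, §4.1] -/
theorem mem_tauLevel_iff (U₀ : Subgroup ↥(finAdelic (↥(maximalRealSubfield L)) L (IsCMField.complexConj L) 3 ((StdForm.antidiagonal 3).over L)))
    (k : (quasiSplit (↥(maximalRealSubfield L)) L (IsCMField.complexConj L) 3).Adelic) :
    k ∈ tauLevel L U₀ ↔ ∃ b ∈ U₀, finAdelicToAdelic (↥(maximalRealSubfield L)) L (IsCMField.complexConj L) 3 ((StdForm.antidiagonal 3).over L) b = k :=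
  Subgroup.mem_map

/-- `ι_f b ∈ ι_f(U₀)` for `b ∈ U₀`. [cite: BorelJacquet1979, §4.1] -/
theorem finAdelicToAdelic_mem_tauLevel {U₀ : Subgroup ↥(finAdelic (↥(maximalRealSubfield L)) L (IsCMField.complexConj L) 3 ((StdForm.antidiagonal 3).over L))}
    {b : ↥(finAdelic (↥(maximalRealSubfield L)) L (IsCMField.complexConj L) 3 ((StdForm.antidiagonal 3).over L))} (hb : b ∈ U₀) :
    finAdelicToAdelic (↥(maximalRealSubfield L)) L (IsCMField.complexConj L) 3 ((StdForm.antidiagonal 3).over L) b ∈ tauLevel L U₀ :=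
  Subgroup.mem_map_of_mem _ hb

/-! ## T2 `ι(K_∞) ≤ G(𝔸)` and `K_∞`-finiteness of a function on `G(𝔸)` -/

/-- **T2 — THE ARCHIMEDEAN MAXIMAL COMPACT INSIDE `G(𝔸)`**: `ι(K_∞) := {k ∈ G(𝔸) | k ∈ K ∧ k ∈ range ι_∞}` (`K = K_∞·GL₃(𝒪̂)` ★ `standardMaximalCompactGL`; the tree's `hKinf` convention «`ι(k) ∈ K`»,
★ `archToAdelic_mem_levelOfRecord`). [cite: BorelJacquet1979, §4.1] -/
def archMaximalCompact : Subgroup (quasiSplit (↥(maximalRealSubfield L)) L (IsCMField.complexConj L) 3).Adelic :=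
  ((standardMaximalCompactGL 3 L).comap (adelicVal (↥(maximalRealSubfield L)) L (IsCMField.complexConj L) 3 ((StdForm.antidiagonal 3).over L)) :
      Subgroup (quasiSplit (↥(maximalRealSubfield L)) L (IsCMField.complexConj L) 3).Adelic) ⊓
    (archToAdelic (↥(maximalRealSubfield L)) L (IsCMField.complexConj L) 3 ((StdForm.antidiagonal 3).over L)).range

/-- Membership in `ι(K_∞)` (definitional): `k ∈ K` and `k = ι a` for some `a ∈ G_∞`. [cite: BorelJacquet1979, §4.1] -/
theorem mem_archMaximalCompact_iff (k : (quasiSplit (↥(maximalRealSubfield L)) L (IsCMField.complexConj L) 3).Adelic) :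
    k ∈ archMaximalCompact L ↔
      adelicVal (↥(maximalRealSubfield L)) L (IsCMField.complexConj L) 3 ((StdForm.antidiagonal 3).over L) k ∈ standardMaximalCompactGL 3 L ∧
        ∃ a : arch (↥(maximalRealSubfield L)) L (IsCMField.complexConj L) 3 ((StdForm.antidiagonal 3).over L),
          archToAdelic (↥(maximalRealSubfield L)) L (IsCMField.complexConj L) 3 ((StdForm.antidiagonal 3).over L) a = k :=
  Iff.rfl

/-- `ι a ∈ ι(K_∞)` as soon as `ι a ∈ K` (the `hKinf` shape). [cite: BorelJacquet1979, §4.1] -/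
theorem archToAdelic_mem_archMaximalCompact (a : arch (↥(maximalRealSubfield L)) L (IsCMField.complexConj L) 3 ((StdForm.antidiagonal 3).over L))
    (ha : adelicVal (↥(maximalRealSubfield L)) L (IsCMField.complexConj L) 3 ((StdForm.antidiagonal 3).over L)
      (archToAdelic (↥(maximalRealSubfield L)) L (IsCMField.complexConj L) 3 ((StdForm.antidiagonal 3).over L) a) ∈ standardMaximalCompactGL 3 L) :
    archToAdelic (↥(maximalRealSubfield L)) L (IsCMField.complexConj L) 3 ((StdForm.antidiagonal 3).over L) a ∈ archMaximalCompact L :=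
  ⟨ha, a, rfl⟩

/-- **T2 — THE SPAN OF THE `K_∞`-TRANSLATES** `span {r(k)φ | k ∈ ι(K_∞)}` of a function `φ` on `G(𝔸)` (★ `AdelicGroupData.rightTranslation`, `r(k)φ = φ(·k)`). [cite: BorelJacquet1979, §1.3, §4.2] -/
def archTranslateSpan (φ : (quasiSplit (↥(maximalRealSubfield L)) L (IsCMField.complexConj L) 3).Adelic → ℂ) :
    Submodule ℂ ((quasiSplit (↥(maximalRealSubfield L)) L (IsCMField.complexConj L) 3).Adelic → ℂ) :=
  Submodule.span ℂ (Set.range fun k : ↥(archMaximalCompact L) =>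
    rightTranslation (quasiSplit (↥(maximalRealSubfield L)) L (IsCMField.complexConj L) 3) (k : (quasiSplit (↥(maximalRealSubfield L)) L (IsCMField.complexConj L) 3).Adelic) φ)

/-- Read-back (`rfl`). [cite: BorelJacquet1979, §1.3] -/
theorem archTranslateSpan_def (φ : (quasiSplit (↥(maximalRealSubfield L)) L (IsCMField.complexConj L) 3).Adelic → ℂ) :
    archTranslateSpan L φ = Submodule.span ℂ (Set.range fun k : ↥(archMaximalCompact L) =>
      rightTranslation (quasiSplit (↥(maximalRealSubfield L)) L (IsCMField.complexConj L) 3) (k : (quasiSplit (↥(maximalRealSubfield L)) L (IsCMField.complexConj L) 3).Adelic) φ) := rfl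

/-- `r(k)φ` lies in the span of the `K_∞`-translates (`k ∈ ι(K_∞)`). [cite: BorelJacquet1979, §1.3] -/
theorem rightTranslation_mem_archTranslateSpan (φ : (quasiSplit (↥(maximalRealSubfield L)) L (IsCMField.complexConj L) 3).Adelic → ℂ) (k : ↥(archMaximalCompact L)) :
    rightTranslation (quasiSplit (↥(maximalRealSubfield L)) L (IsCMField.complexConj L) 3) (k : (quasiSplit (↥(maximalRealSubfield L)) L (IsCMField.complexConj L) 3).Adelic) φ ∈
      archTranslateSpan L φ :=
  Submodule.subset_span ⟨k, rfl⟩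

/-- `φ = r(1)φ` lies in the span of its `K_∞`-translates. [cite: BorelJacquet1979, §1.3] -/
theorem mem_archTranslateSpan_self (φ : (quasiSplit (↥(maximalRealSubfield L)) L (IsCMField.complexConj L) 3).Adelic → ℂ) : φ ∈ archTranslateSpan L φ := by
  have h := rightTranslation_mem_archTranslateSpan L φ 1
  rwa [OneMemClass.coe_one, map_one] at h

/-- **T2 — `K_∞`-FINITENESS** (S8-R199: `FiniteDimensional (span {r(k)φ | k ∈ K_∞})`). [cite: BorelJacquet1979, §1.3, §4.2] [cite: MoeglinWaldspurger1995, I.2.17] -/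
def IsArchFinite (φ : (quasiSplit (↥(maximalRealSubfield L)) L (IsCMField.complexConj L) 3).Adelic → ℂ) : Prop :=
  FiniteDimensional ℂ ↥(archTranslateSpan L φ)

/-- Read-back (`Iff.rfl`). [cite: BorelJacquet1979, §1.3] -/
theorem isArchFinite_iff (φ : (quasiSplit (↥(maximalRealSubfield L)) L (IsCMField.complexConj L) 3).Adelic → ℂ) :
    IsArchFinite L φ ↔ FiniteDimensional ℂ ↥(archTranslateSpan L φ) := Iff.rfl

/-! ## T3 The τ-admissible generators and atoms at a τ-level `U₀` -/

variable (μ : Measure (quasiSplit (↥(maximalRealSubfield L)) L (IsCMField.complexConj L) 3).automorphicQuotient)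

/-- **T3 — THE τ-ADMISSIBLE GENERATORS** of the middle-pole residue atom of `ξ` at the τ-level `U₀`: ★ D1 `resGMidAtomGen`'s clause list BYTE FOR BYTE at `(K′, ω) := (tauLevel U₀, 1)` with
ONE more binder — the section `φ` is `K_∞`-FINITE (`IsArchFinite φ`).  (Open∕compact∕integral of `U₀` is carried by the hull's index `IsTauLevel U₀`, T4.) [cite: Rogawski1990, §13.9 p. 229 (ii)]
[cite: MoeglinWaldspurger1995, I.2.17, IV.1.11, V.3.13] -/
def resGMidAtomGenτ (ξ : OneDimAutRepH L) (μω : HeckeCharacter L)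
    (U₀ : Subgroup ↥(finAdelic (↥(maximalRealSubfield L)) L (IsCMField.complexConj L) 3 ((StdForm.antidiagonal 3).over L))) :
    Set ((quasiSplit (↥(maximalRealSubfield L)) L (IsCMField.complexConj L) 3).L2 μ) :=
  {f | ∃ (φ : (quasiSplit (↥(maximalRealSubfield L)) L (IsCMField.complexConj L) 3).Adelic → ℂ)
      (_ : φ ∈ chiSectionSpacePair (ξ.bcη⁻¹ * ξ.bcψ⁻¹ * μω) ξ.ψ (tauLevel L U₀) ((1 : ↥(tauLevel L U₀) →* ℂ) : ↥(tauLevel L U₀) → ℂ)) (_ : Continuous φ)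
      (_ : IsArchFinite L φ)
      (Ec : ℂ → (quasiSplit (↥(maximalRealSubfield L)) L (IsCMField.complexConj L) 3).Adelic → ℂ) (Sp : Finset ℂ)
      (_ : ∀ s ∈ Sp, s.im = 0 ∧ 1 < s.re ∧ s.re ≤ 2)
      (_ : ∀ g, DifferentiableOn ℂ (fun z => Ec z g) ({z : ℂ | 1 < z.re} \ (↑Sp : Set ℂ)))
      (_ : ∀ z : ℂ, 2 < z.re → Ec z = eisensteinSeriesU (flatSectionU φ z))
      (Fp : (quasiSplit (↥(maximalRealSubfield L)) L (IsCMField.complexConj L) 3).Adelic → ℂ → ℂ)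
      (_ : ∀ g, AnalyticAt ℂ (Fp g) ((3 : ℂ) / 2))
      (_ : ∀ g, Fp g =ᶠ[𝓝[≠] ((3 : ℂ) / 2)] fun z => (z - (3 : ℂ) / 2) * Ec z g),
      (f : (quasiSplit (↥(maximalRealSubfield L)) L (IsCMField.complexConj L) 3).automorphicQuotient → ℂ) =ᵐ[μ]
        fun x => Fp (Quotient.out (x : (quasiSplit (↥(maximalRealSubfield L)) L (IsCMField.complexConj L) 3).Adelic ⧸
          (quasiSplit (↥(maximalRealSubfield L)) L (IsCMField.complexConj L) 3).quotientSubgroup))⁻¹ ((3 : ℂ) / 2)}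

/-- Membership in the τ-admissible generator set (`Iff.rfl`; the shape a payer's residue lemma targets). [cite: Rogawski1990, §13.9 p. 229 (ii)] [cite: MoeglinWaldspurger1995, IV.1.11] -/
theorem mem_resGMidAtomGenτ_iff (ξ : OneDimAutRepH L) (μω : HeckeCharacter L)
    (U₀ : Subgroup ↥(finAdelic (↥(maximalRealSubfield L)) L (IsCMField.complexConj L) 3 ((StdForm.antidiagonal 3).over L)))
    (f : (quasiSplit (↥(maximalRealSubfield L)) L (IsCMField.complexConj L) 3).L2 μ) :
    f ∈ resGMidAtomGenτ L μ ξ μω U₀ ↔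
      ∃ (φ : (quasiSplit (↥(maximalRealSubfield L)) L (IsCMField.complexConj L) 3).Adelic → ℂ)
        (_ : φ ∈ chiSectionSpacePair (ξ.bcη⁻¹ * ξ.bcψ⁻¹ * μω) ξ.ψ (tauLevel L U₀) ((1 : ↥(tauLevel L U₀) →* ℂ) : ↥(tauLevel L U₀) → ℂ)) (_ : Continuous φ)
        (_ : IsArchFinite L φ)
        (Ec : ℂ → (quasiSplit (↥(maximalRealSubfield L)) L (IsCMField.complexConj L) 3).Adelic → ℂ) (Sp : Finset ℂ)
        (_ : ∀ s ∈ Sp, s.im = 0 ∧ 1 < s.re ∧ s.re ≤ 2)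
        (_ : ∀ g, DifferentiableOn ℂ (fun z => Ec z g) ({z : ℂ | 1 < z.re} \ (↑Sp : Set ℂ)))
        (_ : ∀ z : ℂ, 2 < z.re → Ec z = eisensteinSeriesU (flatSectionU φ z))
        (Fp : (quasiSplit (↥(maximalRealSubfield L)) L (IsCMField.complexConj L) 3).Adelic → ℂ → ℂ)
        (_ : ∀ g, AnalyticAt ℂ (Fp g) ((3 : ℂ) / 2))
        (_ : ∀ g, Fp g =ᶠ[𝓝[≠] ((3 : ℂ) / 2)] fun z => (z - (3 : ℂ) / 2) * Ec z g),
        (f : (quasiSplit (↥(maximalRealSubfield L)) L (IsCMField.complexConj L) 3).automorphicQuotient → ℂ) =ᵐ[μ]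
          fun x => Fp (Quotient.out (x : (quasiSplit (↥(maximalRealSubfield L)) L (IsCMField.complexConj L) 3).Adelic ⧸
            (quasiSplit (↥(maximalRealSubfield L)) L (IsCMField.complexConj L) 3).quotientSubgroup))⁻¹ ((3 : ℂ) / 2) :=
  Iff.rfl

variable (ξ : OneDimAutRepH L) (μω : HeckeCharacter L)
  (U₀ : Subgroup ↥(finAdelic (↥(maximalRealSubfield L)) L (IsCMField.complexConj L) 3 ((StdForm.antidiagonal 3).over L)))

/-- **THE JUNCTION WITH ★ D1: every τ-admissible generator at `U₀` IS a generator at `(K′, ω) = (tauLevel U₀, 1)`** (drop the `K_∞`-finiteness binder). [cite: Rogawski1990, §13.9 p. 229 (ii)] -/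
theorem resGMidAtomGenτ_subset : resGMidAtomGenτ L μ ξ μω U₀ ⊆ resGMidAtomGen L μ ξ μω (tauLevel L U₀) 1 :=
  fun _ ⟨φ, hφ, hc, _, Ec, Sp, hSp, hEc, hEis, Fp, hFp, hres, hae⟩ => ⟨φ, hφ, hc, Ec, Sp, hSp, hEc, hEis, Fp, hFp, hres, hae⟩

/-- **T3 — THE τ-ADMISSIBLE MIDDLE-POLE RESIDUE ATOM of `ξ` at the τ-level `U₀`**: the closed span in `L²` of the τ-admissible generators. [cite: Rogawski1990, §13.9 p. 229 (ii)]
[cite: MoeglinWaldspurger1995, V.3.13] -/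
def resGMidAtomτ : Submodule ℂ ((quasiSplit (↥(maximalRealSubfield L)) L (IsCMField.complexConj L) 3).L2 μ) :=
  (Submodule.span ℂ (resGMidAtomGenτ L μ ξ μω U₀)).topologicalClosure

/-- Read-back (`rfl`). [cite: MoeglinWaldspurger1995, V.3.13] -/
theorem resGMidAtomτ_def : resGMidAtomτ L μ ξ μω U₀ = (Submodule.span ℂ (resGMidAtomGenτ L μ ξ μω U₀)).topologicalClosure := rfl

/-- Read-back: the τ-admissible generators lie in the τ-atom. [cite: MoeglinWaldspurger1995, V.3.13] -/
theorem subset_resGMidAtomτ : resGMidAtomGenτ L μ ξ μω U₀ ⊆ (resGMidAtomτ L μ ξ μω U₀ : Set ((quasiSplit (↥(maximalRealSubfield L)) L (IsCMField.complexConj L) 3).L2 μ)) :=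
  Submodule.subset_span.trans (Submodule.le_topologicalClosure _)

/-- Read-back: the algebraic span of the τ-admissible generators lies in the τ-atom. [cite: MoeglinWaldspurger1995, V.3.13] -/
theorem span_le_resGMidAtomτ : Submodule.span ℂ (resGMidAtomGenτ L μ ξ μω U₀) ≤ resGMidAtomτ L μ ξ μω U₀ :=
  Submodule.le_topologicalClosure _

/-- Read-back: the τ-atom is closed. [cite: MoeglinWaldspurger1995, V.3.13] -/
theorem isClosed_resGMidAtomτ : IsClosed (resGMidAtomτ L μ ξ μω U₀ : Set ((quasiSplit (↥(maximalRealSubfield L)) L (IsCMField.complexConj L) 3).L2 μ)) :=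
  Submodule.isClosed_topologicalClosure _

/-- Read-back (payer's entry point): an `L²` class with the τ-admissible generator property lies in the τ-atom. [cite: Rogawski1990, §13.9 p. 229 (ii)] -/
theorem mem_resGMidAtomτ_of_mem_gen {f : (quasiSplit (↥(maximalRealSubfield L)) L (IsCMField.complexConj L) 3).L2 μ} (hf : f ∈ resGMidAtomGenτ L μ ξ μω U₀) :
    f ∈ resGMidAtomτ L μ ξ μω U₀ :=
  subset_resGMidAtomτ L μ ξ μω U₀ hf

/-- **THE τ-ATOM LIES IN ★ D2's ATOM AT `(tauLevel U₀, 1)`** (`topologicalClosure_mono ∘ span_mono` of `resGMidAtomGenτ_subset`). [cite: MoeglinWaldspurger1995, V.3.13] -/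
theorem resGMidAtomτ_le_resGMidAtom : resGMidAtomτ L μ ξ μω U₀ ≤ resGMidAtom L μ ξ μω (tauLevel L U₀) 1 :=
  Submodule.topologicalClosure_mono (Submodule.span_mono (resGMidAtomGenτ_subset L μ ξ μω U₀))

/-! ## T4 The τ-admissible block `resGMidBlockτ ξ μω` — the closed invariant hull of the τ-atoms over the τ-admissible levels — and the junction `≤ resGMidBlock ξ μω` -/

variable [(quasiSplit (↥(maximalRealSubfield L)) L (IsCMField.complexConj L) 3).IsAutomorphicMeasure μ]

/-- **T4 — THE τ-ADMISSIBLE MIDDLE BLOCK `resGMidBlockτ ξ μω`**: the smallest CLOSED `R(G(𝔸))`-INVARIANT subspace of `L²` containing the τ-atoms `resGMidAtomτ ξ μω U₀` at EVERY τ-admissible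
level `U₀` (`IsTauLevel U₀`; ★ `ClosedSubrep.generate`) — in the mathematics, the closed span of the residues at the middle pole of the `K`-FINITE Eisenstein series of the `φ_ξ`-block
[MW95 II.1, V.3.13]; the candidate carrier of (E)∕(M)∕(R)′∕(V)∕(V♭) in a B ED. 8 (LEAD's call). [cite: Rogawski1990, §12.2 (3) p. 173] [cite: Rogawski1990, §13.9 p. 229 (ii)]
[cite: MoeglinWaldspurger1995, II.1, V.3.13] -/
def resGMidBlockτ (ξ : OneDimAutRepH L) (μω : HeckeCharacter L) :
    ClosedSubrep ((quasiSplit (↥(maximalRealSubfield L)) L (IsCMField.complexConj L) 3).rightRegular μ) :=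
  ClosedSubrep.generate ((quasiSplit (↥(maximalRealSubfield L)) L (IsCMField.complexConj L) 3).rightRegular μ)
    (⋃ (U₀ : Subgroup ↥(finAdelic (↥(maximalRealSubfield L)) L (IsCMField.complexConj L) 3 ((StdForm.antidiagonal 3).over L))) (_ : IsTauLevel L U₀),
      (resGMidAtomτ L μ ξ μω U₀ : Set ((quasiSplit (↥(maximalRealSubfield L)) L (IsCMField.complexConj L) 3).L2 μ)))

/-- Read-back (`rfl`). [cite: MoeglinWaldspurger1995, V.3.13] -/
theorem resGMidBlockτ_def : resGMidBlockτ L μ ξ μω =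
    ClosedSubrep.generate ((quasiSplit (↥(maximalRealSubfield L)) L (IsCMField.complexConj L) 3).rightRegular μ)
      (⋃ (U₀ : Subgroup ↥(finAdelic (↥(maximalRealSubfield L)) L (IsCMField.complexConj L) 3 ((StdForm.antidiagonal 3).over L))) (_ : IsTauLevel L U₀),
        (resGMidAtomτ L μ ξ μω U₀ : Set ((quasiSplit (↥(maximalRealSubfield L)) L (IsCMField.complexConj L) 3).L2 μ))) := rfl

variable {U₀} in
/-- **Every τ-atom at a τ-admissible level lies in the τ-block** (★ `ClosedSubrep.subset_generate`). [cite: MoeglinWaldspurger1995, V.3.13] -/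
theorem resGMidAtomτ_le_resGMidBlockτ (hU₀ : IsTauLevel L U₀) : resGMidAtomτ L μ ξ μω U₀ ≤ (resGMidBlockτ L μ ξ μω).toSubmodule := fun _ hf =>
  ClosedSubrep.subset_generate _ (Set.mem_iUnion.2 ⟨U₀, Set.mem_iUnion.2 ⟨hU₀, hf⟩⟩)

variable {U₀} in
/-- A τ-admissible generator at a τ-admissible level lies in the τ-block. [cite: Rogawski1990, §13.9 p. 229 (ii)] -/
theorem mem_resGMidBlockτ_of_mem_gen (hU₀ : IsTauLevel L U₀) {f : (quasiSplit (↥(maximalRealSubfield L)) L (IsCMField.complexConj L) 3).L2 μ}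
    (hf : f ∈ resGMidAtomGenτ L μ ξ μω U₀) : f ∈ (resGMidBlockτ L μ ξ μω).toSubmodule :=
  resGMidAtomτ_le_resGMidBlockτ L μ ξ μω hU₀ (mem_resGMidAtomτ_of_mem_gen L μ ξ μω U₀ hf)

variable {U₀} in
/-- **(V)τ-interface — the τ-block is non-zero as soon as ONE τ-atom at a τ-admissible level has a non-zero vector.** [cite: Rogawski1990, §13.9 p. 229 (ii)] -/
theorem resGMidBlockτ_ne_bot_of_mem (hU₀ : IsTauLevel L U₀) {f : (quasiSplit (↥(maximalRealSubfield L)) L (IsCMField.complexConj L) 3).L2 μ}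
    (hf : f ∈ resGMidAtomτ L μ ξ μω U₀) (hf0 : f ≠ 0) : (resGMidBlockτ L μ ξ μω).toSubmodule ≠ ⊥ := fun h =>
  hf0 ((Submodule.mem_bot ℂ).1 (h ▸ resGMidAtomτ_le_resGMidBlockτ L μ ξ μω hU₀ hf))

/-- **Minimality of the τ-block**: any closed invariant subspace containing every τ-atom at every τ-admissible level contains `resGMidBlockτ ξ μω` (★ `ClosedSubrep.generate_le`).
[cite: MoeglinWaldspurger1995, V.3.13] -/
theorem resGMidBlockτ_le (W : ClosedSubrep ((quasiSplit (↥(maximalRealSubfield L)) L (IsCMField.complexConj L) 3).rightRegular μ))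
    (hW : ∀ U₀ : Subgroup ↥(finAdelic (↥(maximalRealSubfield L)) L (IsCMField.complexConj L) 3 ((StdForm.antidiagonal 3).over L)), IsTauLevel L U₀ →
      resGMidAtomτ L μ ξ μω U₀ ≤ W.toSubmodule) :
    resGMidBlockτ L μ ξ μω ≤ W :=
  ClosedSubrep.generate_le (Set.iUnion_subset fun U₀ => Set.iUnion_subset fun hU₀ => hW U₀ hU₀)

/-- **THE JUNCTION: `resGMidBlockτ ξ μω ≤ resGMidBlock ξ μω`** — every τ-atom lies in ★ D2's atom at `(tauLevel U₀, 1)` (`resGMidAtomτ_le_resGMidAtom`), hence in ★ D3's hull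
(★ `resGMidAtom_le_resGMidBlock`); minimality.  So (R)′∕(M)∕(V♭) over the τ-block follow from their ★∕socket forms over `resGMidBlock` by ONE `le_trans`. [cite: MoeglinWaldspurger1995, V.3.13] -/
theorem resGMidBlockτ_le_resGMidBlock : resGMidBlockτ L μ ξ μω ≤ resGMidBlock L μ ξ μω :=
  resGMidBlockτ_le L μ ξ μω _ fun U₀ _ => (resGMidAtomτ_le_resGMidAtom L μ ξ μω U₀).trans (resGMidAtom_le_resGMidBlock L μ ξ μω (tauLevel L U₀) 1)

/-- Submodule form of the junction. [cite: MoeglinWaldspurger1995, V.3.13] -/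
theorem toSubmodule_resGMidBlockτ_le : (resGMidBlockτ L μ ξ μω).toSubmodule ≤ (resGMidBlock L μ ξ μω).toSubmodule :=
  ClosedSubrep.toSubmodule_le_iff.2 (resGMidBlockτ_le_resGMidBlock L μ ξ μω)

/-- **(V♭)τ FROM (V♭) VERBATIM**: `resGMidBlock ξ μω = ⊥ → resGMidBlockτ ξ μω = ⊥`. [cite: Rogawski1990, §13.9 p. 229 (ii)] -/
theorem resGMidBlockτ_eq_bot_of_resGMidBlock_eq_bot (h : resGMidBlock L μ ξ μω = ⊥) : resGMidBlockτ L μ ξ μω = ⊥ :=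
  le_bot_iff.1 (h ▸ resGMidBlockτ_le_resGMidBlock L μ ξ μω)

/-- **(E)'s index passage, family form**: `⨆_k (resGMidBlockτ (ξs k) μω) ≤ ⨆_k (resGMidBlock (ξs k) μω)` as submodules. [cite: MoeglinWaldspurger1995, V.3.13] -/
theorem iSup_resGMidBlockτ_le_iSup_resGMidBlock {κ : Type*} (ξs : κ → OneDimAutRepH L) :
    ⨆ k, (resGMidBlockτ L μ (ξs k) μω).toSubmodule ≤ ⨆ k, (resGMidBlock L μ (ξs k) μω).toSubmodule :=
  iSup_mono fun k => toSubmodule_resGMidBlockτ_le L μ (ξs k) μω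

end Summit.HodgeConjecture.HodgeConjecture.R90.S8

end
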